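import Literature.NumberTheory.EllipticCurves.Rank1Residual.Typed.PAdicCertificateEngine
import HarnessLib

/-!
# The engine instantiated where both inputs ARE tree facts: reducible good ordinary `p ≥ 5` (Wuthrich Thm. 16 + Perrin-Riou–Schneider)

HONEST FRAMING (run/shared/lean/b2b/bsd-rank1-residual/, verbatim): the goal of the cell is to
DELETE the COMBINATION-SHAPED residual classes for ALL analytic-rank `≤ 1` elliptic curves over `ℚ`
— "full BSD formula for every rank `≤ 1` curve in class C" assembled STRICTLY from published
theorems — so that the rank-`≤ 1` remainder becomes exactly the CONSTRUCTION-SHAPED classes, which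
are TYPED (missing-input `Prop`s), NOT attempted. This is not "finishing BSD".

Theorems only. A CONSISTENCY CHECK of the fact-agnostic engine `Typed/PAdicCertificateEngine.lean`
(p179575): at a good ordinary prime `p ≥ 5` with `E[p]` REDUCIBLE both class-level inputs of the
engine are NAMED FACTS of the tree — the divisibility is Wuthrich 2014 Thm. 16
(`Wuthrich2014.charIdeal_dvd_padicLFunction`: `ϖ · L_p(f, α) = ι g`, `g ∈ char_Λ X`) and the
leading-term shape is Perrin-Riou–Schneider as printed by Balakrishnan–Müller–Stein 2016 Thm. 1.7
(`Schneider1985_order_charGenerator`: `T^r ∣ f_E`; `ord f_E = r ↔ (Reg_p ≠ 0 ∧ Ш[p^∞] finite)`;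
`[T^r]f_E · log_p(γ)^r · #E(ℚ)_tors² = u · (1 - α⁻¹)² · #Ш[p^∞] · Reg_p · ∏ c_ℓ`) — so the engine's
hypotheses `hι`, `hXk`, `hLT` are DISCHARGED (with `e = 0`, `c = ϖ`, `k = r = rank E(ℚ)`,
`A = (1 - α⁻¹)² · ∏ c_ℓ`, `B = log_p(γ)^r · #E(ℚ)_tors²`, `R = Reg_p(E, Dh)` for THE canonical
height), leaving exactly the per-curve computed data: `ord_{T=0} L_p(f, α) = r` and the valuation
equality. Result: `Ш(E/ℚ)[p] = 0` — the certificate form, for ANY rank, of x1b gen 1's inequality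
`padicBSD_inequality_of_charIdeal_dvd` (same inputs) and of x1b gen 3's rank-one
`bsdp_and_mainConjecture_of_rank_one_of_shaAn_unit`; it is what the engine will give verbatim at
`p ‖ N` once Skinner 2016 Thm. A / Jones 1989 are typed (REPORT-g4.md H3). Class X1-type input
(reducible `p`), recorded here only as the engine's unit test; NOT a class theorem.

References: [Wuthrich2014] Thm. 16 (p. 393); [BalakrishnanMullerStein2015] Thm. 1.7;
[SteinWuthrich2013] §§3–4 (the certificate under surjectivity); [Miller2011LMS] Prop. 7.6.
-/

set_option autoImplicit false

noncomputable section

open scoped Classical MatrixGroups ModularForm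

open CongruenceSubgroup WeierstrassCurve Literature.NumberTheory.EllipticCurves
  Literature.NumberTheory.EllipticCurves.ModularForms
  Literature.NumberTheory.EllipticCurves.Rank1Residual
  Literature.NumberTheory.EllipticCurves.Wuthrich2014

namespace Literature.NumberTheory.EllipticCurves.Rank1Residual.Typed

/-- **Reducible good ordinary `p ≥ 5`: Wuthrich Thm. 16 + Perrin-Riou–Schneider + the per-curve
`p`-adic certificate give `Ш(E/ℚ)[p] = 0`, THROUGH the engine.** `W` globally minimal, `p ≥ 5` good
ordinary with `E[p]` reducible, `f` a newform of `E`, `ϖ ≠ 0` with `ϖ · Ω_E = Ω⁺_f`, `Dh` THE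
canonical `p`-adic height datum, `r = rank E(ℚ)`; named facts `hW16` (Wuthrich 2014 Thm. 16) and `hS`
(Perrin-Riou–Schneider, BMS 2016 Thm. 1.7); computed data: `ord_{T=0} L_p(f, α) = r` (`hord`) and
`ord_p(ϖ · [T^r]L_p · log_p(γ)^r · #E(ℚ)_tors²) = ord_p((1 - α⁻¹)² · ∏ c_ℓ · Reg_p)` (`hcert`).
Conclusion: every `p`-torsion class of `Ш(E/ℚ)` is `0`. Instance of
`noPTorsion_of_leadingTerm_certificate` with `e = 0`. [cite: Wuthrich2014, Thm. 16 (p. 393)]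
[cite: BalakrishnanMullerStein2015, Thm. 1.7] -/
theorem noPTorsion_of_wuthrich16_of_leadingTerm_certificate (hW16 : charIdeal_dvd_padicLFunction)
    (hS : Schneider1985_order_charGenerator)
    (W : WeierstrassCurve ℚ) [W.IsElliptic] [W.IsGloballyMinimal] (p : ℕ) [Fact p.Prime]
    (hp : 5 ≤ p) (hgood : W.HasGoodReductionAtPrime p) (hordp : ¬ (p : ℤ) ∣ W.frobeniusTrace p)
    (hred : ¬ W.HasIrreducibleModPGaloisRep p)
    {N : ℕ} [NeZero N] (f : CuspForm (Gamma0 N) 2) (hf : IsNewformOf W f)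
    (ϖ : ℚ) (hϖ0 : ϖ ≠ 0) (hϖ : (ϖ : ℝ) * W.realPeriodRat = plusPeriod f)
    (Dh : PAdicHeightData W p) (hDh : Dh.IsCanonical)
    (hord : (padicLFunction f (unitRoot W p : ℚ_[p])).order = W.mordellWeilRank)
    (hcert : (((ϖ : ℚ) : ℚ_[p]) *
          PowerSeries.coeff W.mordellWeilRank (padicLFunction f (unitRoot W p : ℚ_[p])) *
          (padicLog p (cyclotomicGenerator p) ^ W.mordellWeilRank * (W.torsionOrder : ℚ_[p]) ^ 2)).valuation =
        ((1 - (unitRoot W p : ℚ_[p])⁻¹) ^ 2 * (W.tamagawaProduct : ℚ_[p]) *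
          padicRegulator Dh).valuation) :
    ∀ x : W.sha, (p : ℤ) • x = 0 → x = 0 := by
  have hp2 : p ≠ 2 := by omega
  have hordin : IsOrdinaryAt W p := ⟨hgood, hordp⟩
  set r := W.mordellWeilRank with hr_def
  set L := padicLFunction f (unitRoot W p : ℚ_[p]) with hL_def
  -- the cyclotomic setting, the Iwasawa module, Wuthrich's Thm. 16, a generator of `char_Λ X`
  obtain ⟨κ, hκ, γ, hγ, hγ'⟩ := exists_isCyclotomic_isTopGenerator_isCyclotomicVariable_holds p
  obtain ⟨D⟩ := W.nonempty_selmerDualData_holds κ γ hγ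
  haveI : Module.Finite (IwasawaAlgebra p) D.X := D.module_finite_holds hγ
  obtain ⟨hX, g, hgmem, hιg⟩ := hW16 W p hp2 hordin hred hκ hγ hγ' hf D ϖ hϖ
  haveI : (Module.charIdeal (IwasawaAlgebra p) D.X).IsPrincipal := charIdeal_isPrincipal_holds p D.X
  obtain ⟨fE, hchar⟩ := Submodule.IsPrincipal.principal (Module.charIdeal (IwasawaAlgebra p) D.X)
  have hchar' : D.charIdeal = Ideal.span {fE} := hchar
  -- the engine's inputs
  have hϖQ : ((ϖ : ℚ) : ℚ_[p]) ≠ 0 := by exact_mod_cast hϖ0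
  have hι : PowerSeries.C ((ϖ : ℚ) : ℚ_[p]) * L = PowerSeries.X ^ 0 * iwasawaToPowerSeries p g := by
    rw [pow_zero, one_mul, hιg]
  have hordL : L.order = (r + 0 : ℕ) := by rw [Nat.add_zero]; exact hord
  have hXk : (PowerSeries.X : IwasawaAlgebra p) ^ r ∣ fE :=
    Schneider1985_order_charGenerator.X_pow_dvd hS hp hgood hordp hκ hγ hγ' D hX hchar' hDh
  -- `A = (1 - α⁻¹)² · ∏ c_ℓ ≠ 0`
  obtain ⟨u₂, hu₂⟩ := exists_unit_one_sub_unitRoot_inv p W hordin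
  have hε0 : (1 - (unitRoot W p : ℚ_[p])⁻¹) ^ 2 ≠ 0 := by
    rw [hu₂]
    refine pow_ne_zero 2 (mul_ne_zero (coe_units_ne_zero p u₂) ?_)
    exact_mod_cast (W.reductionPointCount_pos p).ne'
  have hc0 : (W.tamagawaProduct : ℚ_[p]) ≠ 0 := by
    exact_mod_cast (W.tamagawaProduct_pos_holds : 0 < W.tamagawaProduct).ne'
  have hA : (1 - (unitRoot W p : ℚ_[p])⁻¹) ^ 2 * (W.tamagawaProduct : ℚ_[p]) ≠ 0 :=
    mul_ne_zero hε0 hc0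
  -- the leading-term shape from Perrin-Riou–Schneider
  have hLT : fE.order = (r : ℕ) →
      Finite (AddCommGroup.primaryComponent W.sha p) ∧ padicRegulator Dh ≠ 0 ∧
        ∃ u : ℤ_[p]ˣ, ((PowerSeries.coeff r fE : ℤ_[p]) : ℚ_[p]) *
            (padicLog p (cyclotomicGenerator p) ^ r * (W.torsionOrder : ℚ_[p]) ^ 2) =
          ((u : ℤ_[p]) : ℚ_[p]) *
            ((1 - (unitRoot W p : ℚ_[p])⁻¹) ^ 2 * (W.tamagawaProduct : ℚ_[p]) * padicRegulator Dh *
              (Nat.card (AddCommGroup.primaryComponent W.sha p) : ℚ_[p])) := by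
    intro hordfE
    obtain ⟨hSch, hfin⟩ := (Schneider1985_order_charGenerator.order_eq_iff hS hp hgood hordp hκ hγ
      hγ' D hX hchar' hDh).mp hordfE
    obtain ⟨u, hu⟩ := Schneider1985_order_charGenerator.leadingCoeff hS hp hgood hordp hκ hγ hγ' D hX
      hchar' hDh hSch hfin
    refine ⟨hfin, hSch, u, ?_⟩
    rw [← mul_assoc, hu]
    ring
  have hcert' : (((ϖ : ℚ) : ℚ_[p]) * PowerSeries.coeff (r + 0) L *
        (padicLog p (cyclotomicGenerator p) ^ r * (W.torsionOrder : ℚ_[p]) ^ 2)).valuation =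
      ((1 - (unitRoot W p : ℚ_[p])⁻¹) ^ 2 * (W.tamagawaProduct : ℚ_[p]) *
        padicRegulator Dh).valuation := by
    rw [Nat.add_zero]; exact hcert
  exact noPTorsion_of_leadingTerm_certificate W p fE g (hchar' ▸ hgmem) L ((ϖ : ℚ) : ℚ_[p]) hϖQ 0 r hι
    hordL _ _ (padicRegulator Dh) hA hXk hLT hcert'

end Literature.NumberTheory.EllipticCurves.Rank1Residual.Typed

end
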